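import Summits.BirchSwinnertonDyer.Rank1Residual.X11b.ShapiroPairs
import HarnessLib

/-!
# BSD rank-≤1 residual cell, class X4 (additive reduction at `p`, `p ≥ 5`): `BSD(E,5)` for window
# residue pairs with mod-5 image of order PRIME TO 5 (`5S4`, `5Nn`) from PUBLISHED theorems + ONE
# full `5`-descent certificate line per pair

HONEST FRAMING (cell `b2b-bsdres-*`, verbatim): prove what is provable now; shrink each hard class
to its core with data; no claim beyond stated classes; COMBINATION classes deleted from PUBLISHED
theorems only, CONSTRUCTION-shaped remainder typed; this is not "finishing BSD". Class X4 stays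
CONSTRUCTION-SHAPED; everything here is PER PAIR; no lane verdict is changed; no named fact; nothing
is booked by this unit (the lane writer / referee A decide).

Unit `b2b-bsdres-x11c` (the cell's `5`-descent engines), gen 14, serving the X4 owners and the hyp
RES-ROADMAP residue (GEN 29 §4.2 category B `S4DESC5`: `8100e1@5`, `8100f1@5`, `16200j1@5` —
additive at `5`, `E[5]` irreducible with EXCEPTIONAL image `5S4` (projective image `S₄`, order
`96`, prime to `5`), rank `0`, `#Ш_an = 1`, outside every surjective-image line and outside the
twist-relocation inputs). They are closed PER PAIR by the generic FULL `5`-DESCENT over ℚ of gen 13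
(method note `HOME/b2b-bsdres-x11c/gen13/S4DESCENT-METHOD.md`; engine
`HOME/code/b2b-bsdres-x11c/gen13/s4desc/`, run here VERBATIM) in the field `R = ℚ(T')` of ONE
`5`-torsion point — degree `24` (the étale algebra of `E[5] ∖ 0`, one field since `G` is
transitive), `Aut(R) ≅ C₄` acting by `T' ↦ [a]T'`, subfield degrees `{1,3,6,12,24}` ENFORCED (this
pattern characterises `5S4` among the transitive subgroups `5Nn`, `5S4`, `GL₂(𝔽₅)`): since
`5 ∤ |G|`, MASCHKE makes the Weil-pairing Kummer map `w_* : H¹(ℚ,E[5]) ↪ Rˣ/Rˣ⁵` injective, and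
`Fake(E) = {ξ ∈ R(S,5) : δξ = ξ^a, loc_ℓ ξ ∈ ⟨f_{T'}(E(ℚ_ℓ))⟩ (ℓ ∣ 5N)}` satisfies
`w_*Sel⁵(E/ℚ) ⊂ Fake(E)`, `dim Fake − dim Sel⁵ ≤ dim K_S(R)`. For all three pairs
**`dim_𝔽₅ Fake(E) = 0`** (`K_S(R) = 0`), hence **`Sel^(5)(E/ℚ) = 0`**, `#Sel^(5)(E/ℚ) = 1 = 5^{r_an}`.
RUNS: x11c run of record **j112305** (this unit, certificates `HOME/b2b-bsdres-x11c/gen14/x4s4/`),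
identical values in the CROSS-SEAT run by the hyp seat (x11c engine byte for byte, kit j107996) and
in x11c's independent verifier on hyp's certificates (kit j108131, 3/3 VERIFIED), and in gen 13's
service-table row (j104951). GRH REMOVED: the class group of each `R` (`|d_R|` = `2¹⁶3³²5¹⁷`,
`2¹⁶3³⁶5¹⁷`, `2³²3³²5¹⁵`; PARI: `ℤ/2`, `ℤ/2`, trivial) is CERTIFIED by ZIMMERT's bound (Bordellès,
*Arithmetic Tales* (2012) Thm 7.51, signature `(4,10)`, `Z = ⌈√|d_R|·e^{−26.518…}⌉` = `29 289`,
`263 593`, `1 499 549`): every prime ideal of norm `≤ Z` (`3 088` / `23 183` / `113 142`; degree-1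
primes up to the free `C₄`-action) decomposed on PARI's generator and the decomposition VERIFIED
EXACTLY (HNF), **0 failures** (kit **j112304**, gen 13's `zimmert_cert.gp` verbatim) ⇒ `Cl(R)` is a
quotient of the computed group (no `5`-part), `Cl_S(R) = 1`, `R(S,5)` EXACT (`5`-saturation by
quintic characters in the run): mode **EXACT(Zimmert)** for all three.

ADDED (same gen, second landing): the four window pairs with image `5Nn` (the normaliser of a
NON-SPLIT Cartan subgroup, order `48`, prime to `5`: the SAME Maschke argument, subfield degrees
`{1,2,3,4,6,8,12,24}` — engine `x5desc` = `s4desc` with the image check generalised; hyp RES-ROADMAP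
GEN 29 §4.6 category E `19575i1@5`, `19575k1@5`, `19575v1@5` and §4.1 category L `19575p1@5`;
all `dim Fake = 0`, kit j112369, Zimmert certificates kit j112773 ⇒ EXACT(Zimmert)), and the
rank-one pair `15150bq1@5` with SURJECTIVE image (category E; exploratory full descent: `w_*`
injective since `H¹(GL₂(𝔽₅), 𝔽₅²) = 0`, `Fake ⊇ w_*Sel`, conclusive because `dim Fake = 1 = rank`;
kit j112470; class group under GRH — mode GRH, stated as such).

What enters the kernel per pair is ONE line: the EXACT hypothesis `hSel : #Sel^(5)(E/ℚ) = 5 ^ r_an`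
of the tree's class-free consumer `Typed.bsdp_of_card_selmerGroup_eq_pow_analyticRank` through
x11c gen 12's literal-model instantiation `X11b.bsdp_of_ainvs_of_card_selmerGroup` (GZK `hGZK`,
`r_an ≤ 1`, `p ∤ #Ш_an` ⟹ Miller's `BSDp`; `Δ ≠ 0` decided in the kernel). Non-kernel inputs per
pair: `r_an = 0` and `#Ш_an = 1` (Cremona; the cell's engines) and the certificate line. PER PAIR;
not a class theorem; nothing booked by this unit (two-implementation standard R-SHA2-2IMPL and the
booking are the lane's / referee A's).

References: J. H. Silverman, *AEC* (2009) X.1, X.4 [SilvermanAEC2009]; E. F. Schaefer, M. Stoll,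
Trans. AMS 356 (2004) §2–3; O. Bordellès, *Arithmetic Tales* (2012) Thm 7.51 (Zimmert's bound);
A. V. Sutherland, Forum Math. Sigma 4 (2016) (subgroups of `GL₂(𝔽₅)`); R. L. Miller, LMS JCM 14
(2011) §1 [Miller2011LMS]; Cremona's tables [Cremona2006].
-/

set_option autoImplicit false

noncomputable section

open scoped Classical

open WeierstrassCurve Literature.NumberTheory.EllipticCurves
  Literature.NumberTheory.EllipticCurves.Rank1Residual
  Literature.NumberTheory.EllipticCurves.Rank1Residual.Typed
  Literature.NumberTheory.EllipticCurves.Rank1Residual.X11RankOneCertificates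
  Summit.BirchSwinnertonDyer.Rank1Residual.X11b

namespace Summit.BirchSwinnertonDyer.Rank1Residual.X4

/-! ### The three window pairs of X4 at `p = 5` with EXCEPTIONAL image `5S4` (RES-ROADMAP `S4DESC5`) -/

/-- **`BSD(E,5)` for `8100e1`** (`N = 8100 = 2²·3⁴·5²`, additive at `5`; Cremona model
`[0, 0, 0, -975, 11750]`; `ρ̄_{E,5}` EXCEPTIONAL `5S4`; rank `0`, `E(ℚ)_tors = 0`, `∏ c_ℓ = 1`,
`#Ш_an = 1`) from GZK and the single certificate line `#Sel^(5)(E/ℚ) = 5 ^ r_an`: full `5`-descent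
(x11c gen 13 engine) in `R = ℚ(T')`, `[R:ℚ] = 24`, `|d_R| = 2¹⁶·3³²·5¹⁷`, subfield degrees
`{1,3,6,12,24}`, `S = {2,3,5}`, `Cl(R) ≅ ℤ/2` with `Cl_S(R) = 1` (PARI under GRH, then CERTIFIED
by Zimmert's bound: `Z = 29 289`, all `3 088` prime ideals of norm `≤ Z` decomposed on PARI's
generator and verified exactly, `0` failures — kit j112304), `18` generators of `R(S,5)`
(`5`-saturated by `66` quintic characters), `δ`-eigenspace of dimension `3` (Galois-action matrix
PROVED by characters, `18/18` columns at full rank), local targets `dim J_ℓ = 0, 0, 1` at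
`ℓ = 2, 3, 5` all reached, `K_S(R) = 0`, **`dim_𝔽₅ Fake(E) = 0`** — hence
**`#Sel^(5)(E/ℚ) = 1`**, mode **EXACT(Zimmert)** (x11c run of record j112305; same value in the
hyp seat's cross-seat run j107996 and x11c's verifier j108131). Kernel: `Δ ≠ 0`. Binders: `hGZK`
(published), `r_an ≤ 1` and `#Ш_an` a `5`-adic unit (Cremona / the cell's engines), `hSel` (this
certificate). [cite: Miller2011LMS, §1 and Def. 1.1] [cite: Cremona2006, Table 1 (Cremona label 8100e1)] -/
theorem bsdp_s8100e1 (hGZK : rank_eq_analyticRank_of_analyticRank_le_one)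
    (W : WeierstrassCurve ℚ) (hW : W = ⟨0, 0, 0, -975, 11750⟩)
    (hr : W.analyticRank ≤ 1) {q : ℚ} (hq : shaAn W = (q : ℂ)) (hv : padicValRat 5 q = 0)
    (hSel : Nat.card (W.selmerGroup (5 : ℤ)) = 5 ^ W.analyticRank) : BSDp W 5 := by
  subst hW
  haveI : Fact (Nat.Prime 5) := ⟨by norm_num⟩
  exact bsdp_of_ainvs_of_card_selmerGroup hGZK 0 0 0 (-975) 11750 (by decide +kernel) 5 hr hq hv hSel

/-- **`BSD(E,5)` for `8100f1`** (`N = 8100 = 2²·3⁴·5²`, additive at `5`; Cremona model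
`[0, 0, 0, 225, -2250]`; `ρ̄_{E,5}` EXCEPTIONAL `5S4`; rank `0`, `E(ℚ)_tors = 0`, `∏ c_ℓ = 1`,
`#Ш_an = 1`) from GZK and the single certificate line `#Sel^(5)(E/ℚ) = 5 ^ r_an`: full `5`-descent
(x11c gen 13 engine) in `R = ℚ(T')`, `[R:ℚ] = 24`, `|d_R| = 2¹⁶·3³⁶·5¹⁷`, subfield degrees
`{1,3,6,12,24}`, `S = {2,3,5}`, `Cl(R) ≅ ℤ/2` with `Cl_S(R) = 1` (PARI under GRH, then CERTIFIED
by Zimmert's bound: `Z = 263 593`, all `23 183` prime ideals of norm `≤ Z` decomposed on PARI's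
generator and verified exactly, `0` failures — kit j112304), `18` generators of `R(S,5)`
(`5`-saturated, `66` characters), `δ`-eigenspace of dimension `3` (Galois action PROVED by
characters), local targets `0, 0, 1` at `ℓ = 2, 3, 5` all reached, `K_S(R) = 0`,
**`dim_𝔽₅ Fake(E) = 0`** — hence **`#Sel^(5)(E/ℚ) = 1`**, mode **EXACT(Zimmert)** (x11c run of
record j112305; same value in hyp's cross-seat run j107996 and x11c's verifier j108131). Kernel:
`Δ ≠ 0`. Binders: `hGZK` (published), `r_an ≤ 1` and `#Ш_an` a `5`-adic unit (Cremona / the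
cell's engines), `hSel` (this certificate).
[cite: Miller2011LMS, §1 and Def. 1.1] [cite: Cremona2006, Table 1 (Cremona label 8100f1)] -/
theorem bsdp_s8100f1 (hGZK : rank_eq_analyticRank_of_analyticRank_le_one)
    (W : WeierstrassCurve ℚ) (hW : W = ⟨0, 0, 0, 225, -2250⟩)
    (hr : W.analyticRank ≤ 1) {q : ℚ} (hq : shaAn W = (q : ℂ)) (hv : padicValRat 5 q = 0)
    (hSel : Nat.card (W.selmerGroup (5 : ℤ)) = 5 ^ W.analyticRank) : BSDp W 5 := by
  subst hW
  haveI : Fact (Nat.Prime 5) := ⟨by norm_num⟩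
  exact bsdp_of_ainvs_of_card_selmerGroup hGZK 0 0 0 225 (-2250) (by decide +kernel) 5 hr hq hv hSel

/-- **`BSD(E,5)` for `16200j1`** (`N = 16200 = 2³·3⁴·5²`, additive at `5`; Cremona model
`[0, 0, 0, -2835, 60750]`; `ρ̄_{E,5}` EXCEPTIONAL `5S4`; rank `0`, `E(ℚ)_tors = 0`, `∏ c_ℓ = 2`,
`#Ш_an = 1`) from GZK and the single certificate line `#Sel^(5)(E/ℚ) = 5 ^ r_an`: full `5`-descent
(x11c gen 13 engine) in `R = ℚ(T')`, `[R:ℚ] = 24`, `|d_R| = 2³²·3³²·5¹⁵`, subfield degrees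
`{1,3,6,12,24}`, `S = {2,3,5}`, `Cl(R) = 1` (PARI under GRH, then CERTIFIED by Zimmert's bound:
`Z = 1 499 549`, all `113 142` prime ideals of norm `≤ Z` decomposed and verified exactly, `0`
failures — kit j112304), `20` generators of `R(S,5)` (`5`-saturated, `72` characters),
`δ`-eigenspace of dimension `3` (Galois action PROVED by characters), local targets `0, 0, 1` at
`ℓ = 2, 3, 5` all reached, `K_S(R) = 0`, **`dim_𝔽₅ Fake(E) = 0`** — hence **`#Sel^(5)(E/ℚ) = 1`**,
mode **EXACT(Zimmert)** (x11c run of record j112305; same value in hyp's cross-seat run j107996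
and x11c's verifier j108131). Kernel: `Δ ≠ 0`. Binders: `hGZK` (published), `r_an ≤ 1` and
`#Ш_an` a `5`-adic unit (Cremona / the cell's engines), `hSel` (this certificate).
[cite: Miller2011LMS, §1 and Def. 1.1] [cite: Cremona2006, Table 1 (Cremona label 16200j1)] -/
theorem bsdp_s16200j1 (hGZK : rank_eq_analyticRank_of_analyticRank_le_one)
    (W : WeierstrassCurve ℚ) (hW : W = ⟨0, 0, 0, -2835, 60750⟩)
    (hr : W.analyticRank ≤ 1) {q : ℚ} (hq : shaAn W = (q : ℂ)) (hv : padicValRat 5 q = 0)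
    (hSel : Nat.card (W.selmerGroup (5 : ℤ)) = 5 ^ W.analyticRank) : BSDp W 5 := by
  subst hW
  haveI : Fact (Nat.Prime 5) := ⟨by norm_num⟩
  exact bsdp_of_ainvs_of_card_selmerGroup hGZK 0 0 0 (-2835) 60750 (by decide +kernel) 5 hr hq hv hSel


/-! ### The four window pairs of X4 at `p = 5` with image `5Nn` (RES-ROADMAP category E / L) — GEN 14 engine `x5desc` -/

/-- **`BSD(E,5)` for `19575i1`** (`N = 19575 = 3³·5²·29`, additive at `5`; Cremona model
`[1, -1, 1, -4955, -133118]`; `ρ̄_{E,5}` = the normaliser of a NON-SPLIT Cartan subgroup (`5Nn`, order `48`,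
prime to `5`); rank `0`, `E(ℚ)_tors = 0`, `∏ c_ℓ = 5`, `#Ш_an = 1`; hyp RES-ROADMAP GEN 29 §4.6
category E — NO per-pair route on file before) from GZK and the single certificate line
`#Sel^(5)(E/ℚ) = 5 ^ r_an`: FULL `5`-descent of unit `b2b-bsdres-x11c` GEN 14 (engine `x5desc` =
gen 13's `s4desc` with the image check generalised: `R = ℚ(T')` of degree `24`, `Aut(R) ≅ C₄`
acting by scalars, subfield degrees `{1,2,3,4,6,8,12,24}` ENFORCED — the pattern that characterises
`5Nn` among the transitive subgroups `5Nn`/`5S4`/`GL₂(𝔽₅)`; `5 ∤ |G|` ⟹ Maschke ⟹ `w_*`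
injective and `dim Fake − dim Sel⁵ ≤ dim K_S(R)`): `|d_R| = 3³⁰·5²¹`, `S = {3,5,29}`, `Cl(R) = 1`
(PARI under GRH, then CERTIFIED by Zimmert's bound: `Z = 954`, all `141` prime ideals of norm
`≤ Z` verified principal / orbit-represented, `0` failures — kit j112773), `30` generators of
`R(S,5)` (`5`-saturated by `102` quintic characters), `δ`-eigenspace of dimension `6` (Galois
action PROVED by characters, `30/30` columns), local targets `dim J_ℓ = 0, 1, 1` at
`ℓ = 3, 5, 29` all reached, `K_S(R) = 0`, **`dim_𝔽₅ Fake(E) = 0`** — hence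
**`#Sel^(5)(E/ℚ) = 1`**, mode **EXACT(Zimmert)** (x11c pilot = run of record kit j112369,
certificates `HOME/b2b-bsdres-x11c/gen14/nn5/`). Kernel: `Δ ≠ 0`. Binders: `hGZK` (published),
`r_an ≤ 1` and `#Ш_an` a `5`-adic unit (Cremona / the cell's engines), `hSel` (this certificate).
[cite: Miller2011LMS, §1 and Def. 1.1] [cite: Cremona2006, Table 1 (Cremona label 19575i1)] -/
theorem bsdp_s19575i1 (hGZK : rank_eq_analyticRank_of_analyticRank_le_one)
    (W : WeierstrassCurve ℚ) (hW : W = ⟨1, -1, 1, -4955, -133118⟩)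
    (hr : W.analyticRank ≤ 1) {q : ℚ} (hq : shaAn W = (q : ℂ)) (hv : padicValRat 5 q = 0)
    (hSel : Nat.card (W.selmerGroup (5 : ℤ)) = 5 ^ W.analyticRank) : BSDp W 5 := by
  subst hW
  haveI : Fact (Nat.Prime 5) := ⟨by norm_num⟩
  exact bsdp_of_ainvs_of_card_selmerGroup hGZK 1 (-1) 1 (-4955) (-133118) (by decide +kernel) 5 hr hq hv hSel

/-- **`BSD(E,5)` for `19575k1`** (`N = 19575 = 3³·5²·29`, additive at `5`; Cremona model
`[1, -1, 1, -1114805, 453731572]`; `ρ̄_{E,5}` = the normaliser of a NON-SPLIT Cartan subgroup (`5Nn`, order `48`,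
prime to `5`); rank `0`, `E(ℚ)_tors = 0`, `∏ c_ℓ = 3`, `#Ш_an = 1`; hyp RES-ROADMAP GEN 29 §4.6
category E — NO per-pair route on file before) from GZK and the single certificate line
`#Sel^(5)(E/ℚ) = 5 ^ r_an`: FULL `5`-descent of unit `b2b-bsdres-x11c` GEN 14 (engine `x5desc` =
gen 13's `s4desc` with the image check generalised: `R = ℚ(T')` of degree `24`, `Aut(R) ≅ C₄`
acting by scalars, subfield degrees `{1,2,3,4,6,8,12,24}` ENFORCED — the pattern that characterises
`5Nn` among the transitive subgroups `5Nn`/`5S4`/`GL₂(𝔽₅)`; `5 ∤ |G|` ⟹ Maschke ⟹ `w_*`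
injective and `dim Fake − dim Sel⁵ ≤ dim K_S(R)`): `|d_R| = 3³⁰·5²¹`, `S = {3,5,29}`, `Cl(R) = 1`
(PARI under GRH, then CERTIFIED by Zimmert's bound: `Z = 954`, all `141` prime ideals of norm
`≤ Z` verified principal / orbit-represented, `0` failures — kit j112773), `30` generators of
`R(S,5)` (`5`-saturated by `102` quintic characters), `δ`-eigenspace of dimension `6` (Galois
action PROVED by characters, `30/30` columns), local targets `dim J_ℓ = 0, 1, 1` at
`ℓ = 3, 5, 29` all reached, `K_S(R) = 0`, **`dim_𝔽₅ Fake(E) = 0`** — hence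
**`#Sel^(5)(E/ℚ) = 1`**, mode **EXACT(Zimmert)** (x11c pilot = run of record kit j112369,
certificates `HOME/b2b-bsdres-x11c/gen14/nn5/`). Kernel: `Δ ≠ 0`. Binders: `hGZK` (published),
`r_an ≤ 1` and `#Ш_an` a `5`-adic unit (Cremona / the cell's engines), `hSel` (this certificate).
[cite: Miller2011LMS, §1 and Def. 1.1] [cite: Cremona2006, Table 1 (Cremona label 19575k1)] -/
theorem bsdp_s19575k1 (hGZK : rank_eq_analyticRank_of_analyticRank_le_one)
    (W : WeierstrassCurve ℚ) (hW : W = ⟨1, -1, 1, -1114805, 453731572⟩)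
    (hr : W.analyticRank ≤ 1) {q : ℚ} (hq : shaAn W = (q : ℂ)) (hv : padicValRat 5 q = 0)
    (hSel : Nat.card (W.selmerGroup (5 : ℤ)) = 5 ^ W.analyticRank) : BSDp W 5 := by
  subst hW
  haveI : Fact (Nat.Prime 5) := ⟨by norm_num⟩
  exact bsdp_of_ainvs_of_card_selmerGroup hGZK 1 (-1) 1 (-1114805) 453731572 (by decide +kernel) 5 hr hq hv hSel

/-- **`BSD(E,5)` for `19575p1`** (`N = 19575 = 3³·5²·29`, additive at `5`; Cremona model
`[1, -1, 0, -44592, 3638771]`; `ρ̄_{E,5}` = the normaliser of a NON-SPLIT Cartan subgroup (`5Nn`, order `48`,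
prime to `5`); rank `0`, `E(ℚ)_tors = 0`, `∏ c_ℓ = 3`, `#Ш_an = 1`; hyp RES-ROADMAP GEN 29 §4.6
category E (19575p1: category L, lane `T-LW`) — NO per-pair route on file before) from GZK and the single certificate line
`#Sel^(5)(E/ℚ) = 5 ^ r_an`: FULL `5`-descent of unit `b2b-bsdres-x11c` GEN 14 (engine `x5desc` =
gen 13's `s4desc` with the image check generalised: `R = ℚ(T')` of degree `24`, `Aut(R) ≅ C₄`
acting by scalars, subfield degrees `{1,2,3,4,6,8,12,24}` ENFORCED — the pattern that characterises
`5Nn` among the transitive subgroups `5Nn`/`5S4`/`GL₂(𝔽₅)`; `5 ∤ |G|` ⟹ Maschke ⟹ `w_*`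
injective and `dim Fake − dim Sel⁵ ≤ dim K_S(R)`): `|d_R| = 3³⁰·5²¹`, `S = {3,5,29}`, `Cl(R) = 1`
(PARI under GRH, then CERTIFIED by Zimmert's bound: `Z = 954`, all `141` prime ideals of norm
`≤ Z` verified principal / orbit-represented, `0` failures — kit j112773), `30` generators of
`R(S,5)` (`5`-saturated by `102` quintic characters), `δ`-eigenspace of dimension `6` (Galois
action PROVED by characters, `30/30` columns), local targets `dim J_ℓ = 0, 1, 1` at
`ℓ = 3, 5, 29` all reached, `K_S(R) = 0`, **`dim_𝔽₅ Fake(E) = 0`** — hence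
**`#Sel^(5)(E/ℚ) = 1`**, mode **EXACT(Zimmert)** (x11c pilot = run of record kit j112369,
certificates `HOME/b2b-bsdres-x11c/gen14/nn5/`). Kernel: `Δ ≠ 0`. Binders: `hGZK` (published),
`r_an ≤ 1` and `#Ш_an` a `5`-adic unit (Cremona / the cell's engines), `hSel` (this certificate).
[cite: Miller2011LMS, §1 and Def. 1.1] [cite: Cremona2006, Table 1 (Cremona label 19575p1)] -/
theorem bsdp_s19575p1 (hGZK : rank_eq_analyticRank_of_analyticRank_le_one)
    (W : WeierstrassCurve ℚ) (hW : W = ⟨1, -1, 0, -44592, 3638771⟩)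
    (hr : W.analyticRank ≤ 1) {q : ℚ} (hq : shaAn W = (q : ℂ)) (hv : padicValRat 5 q = 0)
    (hSel : Nat.card (W.selmerGroup (5 : ℤ)) = 5 ^ W.analyticRank) : BSDp W 5 := by
  subst hW
  haveI : Fact (Nat.Prime 5) := ⟨by norm_num⟩
  exact bsdp_of_ainvs_of_card_selmerGroup hGZK 1 (-1) 0 (-44592) 3638771 (by decide +kernel) 5 hr hq hv hSel

/-- **`BSD(E,5)` for `19575v1`** (`N = 19575 = 3³·5²·29`, additive at `5`; Cremona model
`[1, -1, 0, -123867, -16763584]`; `ρ̄_{E,5}` = the normaliser of a NON-SPLIT Cartan subgroup (`5Nn`, order `48`,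
prime to `5`); rank `0`, `E(ℚ)_tors = 0`, `∏ c_ℓ = 5`, `#Ш_an = 1`; hyp RES-ROADMAP GEN 29 §4.6
category E — NO per-pair route on file before) from GZK and the single certificate line
`#Sel^(5)(E/ℚ) = 5 ^ r_an`: FULL `5`-descent of unit `b2b-bsdres-x11c` GEN 14 (engine `x5desc` =
gen 13's `s4desc` with the image check generalised: `R = ℚ(T')` of degree `24`, `Aut(R) ≅ C₄`
acting by scalars, subfield degrees `{1,2,3,4,6,8,12,24}` ENFORCED — the pattern that characterises
`5Nn` among the transitive subgroups `5Nn`/`5S4`/`GL₂(𝔽₅)`; `5 ∤ |G|` ⟹ Maschke ⟹ `w_*`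
injective and `dim Fake − dim Sel⁵ ≤ dim K_S(R)`): `|d_R| = 3³⁰·5²¹`, `S = {3,5,29}`, `Cl(R) = 1`
(PARI under GRH, then CERTIFIED by Zimmert's bound: `Z = 954`, all `141` prime ideals of norm
`≤ Z` verified principal / orbit-represented, `0` failures — kit j112773), `30` generators of
`R(S,5)` (`5`-saturated by `102` quintic characters), `δ`-eigenspace of dimension `6` (Galois
action PROVED by characters, `30/30` columns), local targets `dim J_ℓ = 0, 1, 1` at
`ℓ = 3, 5, 29` all reached, `K_S(R) = 0`, **`dim_𝔽₅ Fake(E) = 0`** — hence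
**`#Sel^(5)(E/ℚ) = 1`**, mode **EXACT(Zimmert)** (x11c pilot = run of record kit j112369,
certificates `HOME/b2b-bsdres-x11c/gen14/nn5/`). Kernel: `Δ ≠ 0`. Binders: `hGZK` (published),
`r_an ≤ 1` and `#Ш_an` a `5`-adic unit (Cremona / the cell's engines), `hSel` (this certificate).
[cite: Miller2011LMS, §1 and Def. 1.1] [cite: Cremona2006, Table 1 (Cremona label 19575v1)] -/
theorem bsdp_s19575v1 (hGZK : rank_eq_analyticRank_of_analyticRank_le_one)
    (W : WeierstrassCurve ℚ) (hW : W = ⟨1, -1, 0, -123867, -16763584⟩)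
    (hr : W.analyticRank ≤ 1) {q : ℚ} (hq : shaAn W = (q : ℂ)) (hv : padicValRat 5 q = 0)
    (hSel : Nat.card (W.selmerGroup (5 : ℤ)) = 5 ^ W.analyticRank) : BSDp W 5 := by
  subst hW
  haveI : Fact (Nat.Prime 5) := ⟨by norm_num⟩
  exact bsdp_of_ainvs_of_card_selmerGroup hGZK 1 (-1) 0 (-123867) (-16763584) (by decide +kernel) 5 hr hq hv hSel

/-! ### The window pair of X4 at `p = 5`, rank one, SURJECTIVE image (RES-ROADMAP category E) — GEN 14 exploratory full descent -/

/-- **`BSD(E,5)` for `15150bq1`** (`N = 15150 = 2·3·5²·101`, additive at `5`; Cremona model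
`[1, 0, 0, -113013, -13813983]`; `ρ̄_{E,5}` SURJECTIVE (`GL₂(𝔽₅)`); rank `1`, generator
`(−198, 999)`, `E(ℚ)_tors = 0`, `#Ш_an = 1`; Heegner indices `600 = 2³·3·5²` in every field of
the lane's index records, so the Kolyvagin/Jetchev bound stops at `ord₅ #Ш ≤ 4`; hyp RES-ROADMAP
GEN 29 §4.6 category E — NO per-pair route on file before) from GZK and the single certificate
line `#Sel^(5)(E/ℚ) = 5 ^ r_an`: FULL `5`-descent in the degree-`24` field `R = ℚ(T')` of ONE
`5`-torsion point (unit `b2b-bsdres-x11c` GEN 14, engine `x5desc` in its exploratory `GL₂`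
mode, kit **j112470**, certificate `HOME/b2b-bsdres-x11c/gen14/gl2/`). SOUNDNESS at a
SURJECTIVE image (no Maschke): the Weil-pairing Kummer map
`w_* : H¹(ℚ, E[5]) → H¹(ℚ, Map(E[5]∖0, μ₅)) = Rˣ/Rˣ⁵` is still INJECTIVE, its kernel being a
quotient of `ker(H¹(G, E[5]) → H¹(G, Map(E[5]∖0, μ₅)))` with `H¹(GL₂(𝔽₅), 𝔽₅²) = 0` (the centre
acts by the non-trivial scalar `2`); the computed group
`Fake(E) = {ξ ∈ R(S,5) : δξ = ξ^a, loc_ℓ ξ ∈ ⟨f_{T'}(E(ℚ_ℓ))⟩ (ℓ ∣ 5N)}` is cut out by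
conditions NECESSARY for `w_*Sel⁵(E/ℚ)` (unramified outside `S`; the scalar automorphism
`δ : T' ↦ [a]T'` of `R` multiplies Weil-pairing classes by `a`; local Kummer images sampled to
their KNOWN dimension `dim E(ℚ_ℓ)[5] + [ℓ = 5]`), so `dim Sel⁵(E/ℚ) ≤ dim Fake(E)` — with NO bound
on the defect in this mode; the descent is conclusive exactly when `dim Fake = rank + dim E(ℚ)[5]`,
which happens here: `|d_R| ≈ 1.37·10⁵⁵`, subfield degrees `{1,6,12,24}` (= image `GL₂(𝔽₅)` among
the transitive subgroups), `S = {2,3,5,101}`, `Cl(R) ≅ ℤ/2` **under GRH** (`bnfinit`; a Zimmert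
certificate is out of reach at this discriminant, `Z ≈ 10¹⁶`), `41` generators of `R(S,5)`
(`5`-saturated by `107` quintic characters), `δ`-eigenspace of dimension `9` (Galois action
PROVED by characters, `41/41` columns), local targets `dim J_ℓ = 1, 1, 1, 1` at
`ℓ = 2, 3, 5, 101` (`#E(ℚ₂)[5] = #E(ℚ₃)[5] = #E(ℚ₁₀₁)[5] = 5`) all reached,
**`dim_𝔽₅ Fake(E) = 1 = rank`** with the generator's Kummer image its non-zero element
(exponent vector uniquely determined by `368` characters) — hence **`#Sel^(5)(E/ℚ) = 5`**,
mode **GRH** (class group of `R` uncertified). Kernel: `Δ ≠ 0`. Binders: `hGZK` (published),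
`r_an ≤ 1` and `#Ш_an` a `5`-adic unit (Cremona / the cell's engines), `hSel` (this certificate,
GRH-conditional as stated). [cite: Miller2011LMS, §1 and Def. 1.1] [cite: Cremona2006, Table 1 (Cremona label 15150bq1)] -/
theorem bsdp_s15150bq1 (hGZK : rank_eq_analyticRank_of_analyticRank_le_one)
    (W : WeierstrassCurve ℚ) (hW : W = ⟨1, 0, 0, -113013, -13813983⟩)
    (hr : W.analyticRank ≤ 1) {q : ℚ} (hq : shaAn W = (q : ℂ)) (hv : padicValRat 5 q = 0)
    (hSel : Nat.card (W.selmerGroup (5 : ℤ)) = 5 ^ W.analyticRank) : BSDp W 5 := by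
  subst hW
  haveI : Fact (Nat.Prime 5) := ⟨by norm_num⟩
  exact bsdp_of_ainvs_of_card_selmerGroup hGZK 1 0 0 (-113013) (-13813983) (by decide +kernel) 5 hr hq hv hSel

end Summit.BirchSwinnertonDyer.Rank1Residual.X4

end
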